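import Literature.Analysis.FluidPDE.ConeCarlemanCoreC12
import Literature.Analysis.FluidPDE.ConeVanishCutoff
import Literature.Analysis.FluidPDE.BackwardUniquenessChainC12
import HarnessLib

/-!
# Vanishing above the level sets of the cone Carleman weight (Li–Šverák 2012, Lemma 2.4)

Analysis/FluidPDE support file (theorems only; no definitions, no named facts) for the proof of
Li–Šverák's backward-uniqueness theorem in cones
(`Literature.Analysis.FluidPDE.coneBackwardUniquenessC12`). This is the Carleman step of the
proof of Lemma 2.4 of the paper, in the class `C¹₂` and in the tree's normalisation of the
weight (`ConeCarlemanWeight`: `φ = s² + a k₁(s)φ₀(y)`): if `v` solves the backward heat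
inequality `|∂ₛv + Δv| ≤ c(|v| + |∇v|)` (`c² ≤ 1/96`) on `]1/2, 3/2[ × D`, `D` an open set
containing the truncated cone `{ε‖y‖ < ⟪y,e⟫, ⟪y,e⟫ > 1}`, vanishes continuously on `s = 1/2`,
has `∂ₛv` locally square integrable, and decays like `|v| + |∇v| ≤ C_d e^{-β'‖y‖²}` in the cone
for `s < 1`, `⟪y,e⟫ ≥ Y₀` ((2.13) of the paper), then `v(s, y) = 0` whenever `1/2 < s < 1`,
`ε‖y‖ < ⟪y,e⟫`, `⟪y,e⟫ > 1` and `k₁(s)φ₀(y) > B = 4(Y₀+1)² + 16` ("Passing to the limit as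
`a → ∞` we see that `v(y, s) = 0` for `1/2 < s < 1` and `φ_B(y, s) > 0`", p. 6 of the paper).
The proof is the paper's ((2.14)–(2.18)), organised as the tree's proof of Seregin's Lemma A.3
(`vanish_core_c12`, `vanish_of_carleman_second_c12`): the cone Carleman inequality for the
cut-off product (`cone_carleman_smul_le_c12`) with the cut-off of `exists_cone_cutoff`, the
three error terms (initial layer, level-set transition `ω`, cut-off at infinity — the last one
is where `α = 2β < 2` is used: `e^{2a‖y‖^{2β}} e^{-β'‖y‖²} → 0`), and the limit `a → ∞`.

* `cone_majorant_of_decay`, `two_mul_rpow_le_of_large` — pointwise majorants;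
* `cone_vanish_core_c12` — the estimate `∫_G e^{2φ}|v|² ≤ C(31(e^{aB+2}K + 1) + 6)`;
* `cone_vanish_of_carleman_c12` — the vanishing above the level set `{k₁φ₀ > B}`.

## References

* [LiSverak2012] Lu Li, V. Šverák, *Backward uniqueness for the heat equation in cones*,
  Comm. PDE 37 (2012), 1414–1429, arXiv:1011.2796 — Lemma 2.4 and its proof, (2.10)–(2.18).
* [Seregin2014] G. Seregin, *Lecture notes on regularity theory for the Navier–Stokes
  equations*, World Scientific 2014 — App. A.3, Lemma A.3 (the template).
-/

noncomputable section

open MeasureTheory Set Function Filter Metric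
open _root_.Topology
open scoped InnerProductSpace RealInnerProductSpace ENNReal

namespace Literature.Analysis.FluidPDE

namespace Carleman

section ConeVanish

variable {E : Type*} [NormedAddCommGroup E] [InnerProductSpace ℝ E] [FiniteDimensional ℝ E]
  [MeasurableSpace E] [BorelSpace E]
variable {F : Type*} [NormedAddCommGroup F] [InnerProductSpace ℝ F] [CompleteSpace F]

/-! ### Pointwise majorants -/

omit [MeasurableSpace E] [BorelSpace E] [CompleteSpace F] in
/-- **Pointwise majorant from the decay (2.13).** If `|v| + |∇v| ≤ C_d e^{-β'‖y‖²}` at `z`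
(`β' > 0`) and `X ≤ e^{β'‖y‖²/2}`, then
`X (1 + ‖y‖²)² (|v|² + |∇v|²) ≤ C_d² C_q e^{-β'‖y‖²}`, `C_q = 2 + 2(4/(eβ'))²`. [cite: LiSverak2012, proof of Lemma 2.4] -/
theorem cone_majorant_of_decay {v : ℝ × E → F} {Cd β' X : ℝ} (hβ' : 0 < β') {z : ℝ × E}
    (hX : X ≤ Real.exp (β' / 2 * ‖z.2‖ ^ 2))
    (hb : ‖v z‖ + Real.sqrt (gradSq v z) ≤ Cd * Real.exp (-(β' * ‖z.2‖ ^ 2))) :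
    X * ((1 + ‖z.2‖ ^ 2) ^ 2 * (‖v z‖ ^ 2 + gradSq v z)) ≤
      Cd ^ 2 * (2 + 2 * (2 / (Real.exp 1 * (β' / 2))) ^ (2 : ℝ)) *
        Real.exp (-(β' * ‖z.2‖ ^ 2)) := by
  set N : ℝ := ‖z.2‖ ^ 2 with hN
  set Cq : ℝ := 2 + 2 * (2 / (Real.exp 1 * (β' / 2))) ^ (2 : ℝ) with hCq
  have hCq0 : 0 ≤ Cq := by positivity
  have hg0 := gradSq_nonneg v z
  have h1 : ‖v z‖ ^ 2 + gradSq v z ≤ (‖v z‖ + Real.sqrt (gradSq v z)) ^ 2 := by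
    have hs := Real.sq_sqrt hg0
    nlinarith [norm_nonneg (v z), Real.sqrt_nonneg (gradSq v z)]
  have h2 : (‖v z‖ + Real.sqrt (gradSq v z)) ^ 2 ≤ (Cd * Real.exp (-(β' * N))) ^ 2 :=
    pow_le_pow_left₀ (by positivity) hb 2
  have h3 : (Cd * Real.exp (-(β' * N))) ^ 2 = Cd ^ 2 * Real.exp (-(2 * β' * N)) := by
    rw [mul_pow, ← Real.exp_nat_mul]; congr 2; push_cast; ring
  have hvg : ‖v z‖ ^ 2 + gradSq v z ≤ Cd ^ 2 * Real.exp (-(2 * β' * N)) := by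
    rw [← h3]; exact h1.trans h2
  have hpoly : (1 + ‖z.2‖ ^ 2) ^ 2 * Real.exp (-(β' / 2 * ‖z.2‖ ^ 2)) ≤ Cq :=
    one_add_sq_sq_mul_exp_le (by positivity) ‖z.2‖
  have hexp : Real.exp (β' / 2 * N) * Real.exp (-(2 * β' * N)) =
      Real.exp (-(β' / 2 * N)) * Real.exp (-(β' * N)) := by
    rw [← Real.exp_add, ← Real.exp_add]; congr 1; ring
  have hq0 : 0 ≤ (1 + ‖z.2‖ ^ 2) ^ 2 := by positivity
  have hL0 : 0 ≤ (1 + ‖z.2‖ ^ 2) ^ 2 * (‖v z‖ ^ 2 + gradSq v z) := by positivity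
  calc X * ((1 + ‖z.2‖ ^ 2) ^ 2 * (‖v z‖ ^ 2 + gradSq v z))
      ≤ Real.exp (β' / 2 * N) * ((1 + ‖z.2‖ ^ 2) ^ 2 * (Cd ^ 2 * Real.exp (-(2 * β' * N)))) := by
        refine mul_le_mul hX (mul_le_mul_of_nonneg_left hvg hq0) hL0 (Real.exp_pos _).le
    _ = Cd ^ 2 * ((1 + ‖z.2‖ ^ 2) ^ 2 * Real.exp (-(β' / 2 * N))) * Real.exp (-(β' * N)) := by
        rw [show Real.exp (β' / 2 * N) * ((1 + ‖z.2‖ ^ 2) ^ 2 * (Cd ^ 2 * Real.exp (-(2 * β' * N)))) =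
          Cd ^ 2 * (1 + ‖z.2‖ ^ 2) ^ 2 * (Real.exp (β' / 2 * N) * Real.exp (-(2 * β' * N))) by ring,
          hexp]
        ring
    _ ≤ Cd ^ 2 * Cq * Real.exp (-(β' * N)) := by
        refine mul_le_mul_of_nonneg_right (mul_le_mul_of_nonneg_left hpoly (sq_nonneg _)) ?_
        exact (Real.exp_pos _).le

omit [FiniteDimensional ℝ E] [MeasurableSpace E] [BorelSpace E] in
/-- **The growth of the weight is beaten by the Gaussian decay when `β < 1`**: for `a ≥ 0`,
`β' > 0`, `β < 1` and `r ≥ max(1, (4a/β')^{1/(2-2β)})`, `2a r^{2β} ≤ (β'/2) r²`. This is the only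
place where `α = 2β < 2` is needed in the proof of Lemma 2.4. [cite: LiSverak2012, proof of Lemma 2.4] -/
theorem two_mul_rpow_le_of_large {a β β' r : ℝ} (hβ1 : β < 1) (ha : 0 ≤ a) (hβ' : 0 < β')
    (hr : max 1 ((4 * a / β') ^ (2 - 2 * β)⁻¹) ≤ r) :
    2 * a * r ^ (2 * β) ≤ β' / 2 * r ^ 2 := by
  have hr1 : 1 ≤ r := le_trans (le_max_left _ _) hr
  have hr0 : 0 < r := by linarith
  have hp : 0 < 2 - 2 * β := by linarith
  have hbase : 0 ≤ 4 * a / β' := by positivity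
  have h1 : (4 * a / β') ^ (2 - 2 * β)⁻¹ ≤ r := le_trans (le_max_right _ _) hr
  have h2 : 4 * a / β' ≤ r ^ (2 - 2 * β) := by
    have h3 := Real.rpow_le_rpow (Real.rpow_nonneg hbase _) h1 hp.le
    rwa [Real.rpow_inv_rpow hbase hp.ne'] at h3
  have h4 : r ^ (2 : ℝ) = r ^ (2 * β) * r ^ (2 - 2 * β) := by
    rw [← Real.rpow_add hr0]; congr 1; ring
  rw [← Real.rpow_two, h4]
  have h5 : 0 ≤ r ^ (2 * β) := Real.rpow_nonneg hr0.le _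
  have h6 := mul_le_mul_of_nonneg_left h2 (mul_nonneg (by positivity : (0 : ℝ) ≤ β' / 2) h5)
  have h7 : β' / 2 * r ^ (2 * β) * (4 * a / β') = 2 * a * r ^ (2 * β) := by
    field_simp
    ring
  rw [h7] at h6
  linarith [h6]

omit [FiniteDimensional ℝ E] [MeasurableSpace E] [BorelSpace E] in
/-- **The weight on the box.** For `1/2 ≤ s ≤ 1`, `⟪y, e⟫ > 0`, `φ₀(y) ≥ 0`:
`e^{2φ(s,y)} ≤ e² e^{2a k₁(s)φ₀(y)}` and `k₁(s)φ₀(y) ≤ φ₀(y)` (`a ≥ 0`). [folklore] -/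
theorem cone_weight_le {a β η : ℝ} {e : E} {z : ℝ × E} (hz1 : 1 / 2 ≤ z.1)
    (hz2 : z.1 ≤ 1) (hφ : 0 ≤ conePhi0 β η e z.2) :
    Real.exp (2 * conePhi a β η e z) ≤
        Real.exp 2 * Real.exp (2 * a * (kA 1 z.1 * conePhi0 β η e z.2)) ∧
      kA 1 z.1 * conePhi0 β η e z.2 ≤ conePhi0 β η e z.2 := by
  obtain ⟨hk0, hk1, -⟩ := kA_one_facts hz1 hz2
  refine ⟨?_, ?_⟩
  · rw [← Real.exp_add, Real.exp_le_exp, conePhi]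
    have h1 : z.1 ^ 2 ≤ 1 := by nlinarith
    linarith
  · calc kA 1 z.1 * conePhi0 β η e z.2 ≤ 1 * conePhi0 β η e z.2 := mul_le_mul_of_nonneg_right hk1 hφ
      _ = _ := one_mul _


/-! ### The core estimate -/

set_option maxHeartbeats 3200000 in
/-- **The core of the proof of Lemma 2.4** (Li–Šverák 2012, (2.14)–(2.18), organised as
Seregin's proof of Lemma A.3). Let the Carleman parameters `β, ε, η = ε^{2β}, a` satisfy the
hypotheses of `carleman_inequality_cone` with moreover `β < 1`, `0 < ε ≤ 1`, `a ≥ 1`; let `D`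
be open and contain the truncated cone `{ε‖y‖ < ⟪y,e⟫, ⟪y,e⟫ > 1}`; let `v` be of class
`C¹ ∩ {∂ₓv ∈ C¹}` on `O = ]1/2, 3/2[ × D` with `|∂ₛv + Δv| ≤ c(|v| + |∇v|)`, `c² ≤ 1/96`,
continuous on `[1/2, 1] × D` with `v(1/2, ·) = 0`, `∂ₛv` square integrable on bounded
measurable subsets of `O`, and `|v| + |∇v| ≤ C_d e^{-β'‖y‖²}` for `s < 1`, `ε‖y‖ < ⟪y,e⟫`,
`⟪y,e⟫ ≥ Y₀` ((2.13)). Let `B = 4(Y₀+1)² + 16` and let `hχex` be the cut-off family of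
`exists_cone_cutoff` (constant `C_χ`). Then for `0 < σ ≤ 1/4`, `R₁ ≥ 1`, on
`G = {1/2 + σ ≤ s ≤ 1, 1 ≤ ⟪y,e⟫ ≤ R₁, k₁(s)φ₀(y) ≥ B}`,
`∫_G e^{2φ}|v|² ≤ C_χ(31(e^{aB+2}K + 1) + 6)`, `K = C_d²C_q ∫𝟙_{[1/2,1]}(s)e^{-β'‖y‖²}`
(the error terms at infinity and in the initial layer being made `≤ 1` by the choice of `R''`
and `θ`). [cite: LiSverak2012, proof of Lemma 2.4, (2.14)–(2.18)] -/
theorem cone_vanish_core_c12 {v : ℝ × E → F} {e : E} {D : Set E}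
    {β ε η a c Cd β' Y₀ Cχ : ℝ} (he : ‖e‖ = 1)
    (hβ : 1 / 2 < β) (hβ1 : β < 1) (hε0 : 0 < ε) (hε1 : ε ≤ 1) (hηε : η = ε ^ (2 * β))
    (hκ : 0 ≤ 2 * β - 1 - 2 * η)
    (hm : 0 ≤ (2 * β - 1 - 2 * η) * (1 - η) ^ 2 - 2 * η * ε ^ 2 * (1 - ε ^ 2))
    (hc₂ : 0 < 8 * β ^ 2 * (1 - η) ^ 2 - 8 * β * η * (1 - η) - 4 * β ^ 2 * η ^ 2) (ha1 : 1 ≤ a)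
    (ha : 2 * ((1 - β) * (9 * ((Module.finrank ℝ E : ℝ) + 4) ^ 2)) ≤
      a * (8 * β ^ 2 * (1 - η) ^ 2 - 8 * β * η * (1 - η) - 4 * β ^ 2 * η ^ 2))
    (hc : c ^ 2 ≤ 1 / 96) (hβ' : 0 < β') (hCχ : 0 < Cχ)
    (hχex : ∀ (B θ R'' : ℝ), 16 ≤ B → 0 < θ → θ ≤ 1 / 8 → 2 ≤ R'' →
      ∃ χ : ℝ × E → ℝ, ContDiff ℝ 2 χ ∧ HasCompactSupport χ ∧
      tsupport χ ⊆ Icc (1 / 2 + θ) (1 - B / (32 * (R'' + 1) ^ 2)) ×ˢ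
        {y : E | ε * ‖y‖ < ⟪y, e⟫ ∧ 2 ≤ ⟪y, e⟫ ∧ ⟪y, e⟫ ≤ R'' + 1 ∧ B / 4 ≤ conePhi0 β η e y} ∧
      (∀ z, 0 ≤ χ z) ∧ (∀ z, χ z ≤ 1) ∧
      (∀ z : ℝ × E, 1 / 2 + 2 * θ ≤ z.1 → z.1 ≤ 1 → 1 ≤ ⟪z.2, e⟫ → ⟪z.2, e⟫ ≤ R'' →
        B / 2 ≤ kA 1 z.1 * conePhi0 β η e z.2 → χ z = 1) ∧
      (∀ z : ℝ × E, (dt χ z + lap χ z) ^ 2 ≤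
        Cχ * (θ⁻¹ ^ 2 * (Icc (1 / 2 + θ) (1 / 2 + 2 * θ)).indicator (fun _ => (1 : ℝ)) z.1 +
          (1 + ‖z.2‖ ^ 2) ^ 2 *
            ({z : ℝ × E | 0 < z.1 ∧ 0 < ⟪z.2, e⟫ ∧
                kA 1 z.1 * conePhi0 β η e z.2 ∈ Icc (B / 4) (B / 2)}.indicator
                (fun _ => (1 : ℝ)) z +
              (Icc R'' (R'' + 1)).indicator (fun _ => (1 : ℝ)) ⟪z.2, e⟫))) ∧
      (∀ z : ℝ × E, gradSq χ z ≤
        Cχ * ((1 + ‖z.2‖ ^ 2) ^ 2 *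
            ({z : ℝ × E | 0 < z.1 ∧ 0 < ⟪z.2, e⟫ ∧
                kA 1 z.1 * conePhi0 β η e z.2 ∈ Icc (B / 4) (B / 2)}.indicator
                (fun _ => (1 : ℝ)) z +
              (Icc R'' (R'' + 1)).indicator (fun _ => (1 : ℝ)) ⟪z.2, e⟫))))
    (hDo : IsOpen D) (hD : ∀ y : E, ε * ‖y‖ < ⟪y, e⟫ → 1 < ⟪y, e⟫ → y ∈ D)
    (hv : ContDiffOn ℝ 1 v (Ioo (1 / 2 : ℝ) (3 / 2) ×ˢ D))
    (hvx : ∀ e' : E, ContDiffOn ℝ 1 (dx e' v) (Ioo (1 / 2 : ℝ) (3 / 2) ×ˢ D))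
    (hBH : ∀ z ∈ Ioo (1 / 2 : ℝ) (3 / 2) ×ˢ D,
      ‖dt v z + lap v z‖ ≤ c * (‖v z‖ + Real.sqrt (gradSq v z)))
    (hcont : ContinuousOn v (Icc (1 / 2 : ℝ) 1 ×ˢ D))
    (h0 : ∀ y ∈ D, v (1 / 2, y) = 0)
    (hH3 : ∀ K ⊆ Ioo (1 / 2 : ℝ) (3 / 2) ×ˢ D, Bornology.IsBounded K →
      MeasurableSet K → ∫⁻ z in K, ‖dt v z‖ₑ ^ 2 < ∞)
    (hdec : ∀ z ∈ Ioo (1 / 2 : ℝ) (3 / 2) ×ˢ D, z.1 < 1 → ε * ‖z.2‖ < ⟪z.2, e⟫ → Y₀ ≤ ⟪z.2, e⟫ →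
      ‖v z‖ + Real.sqrt (gradSq v z) ≤ Cd * Real.exp (-(β' * ‖z.2‖ ^ 2)))
    {σ R₁ : ℝ} (hσ : 0 < σ) (hσ1 : σ ≤ 1 / 4) (hR₁ : 1 ≤ R₁) :
    ∫ z in {z : ℝ × E | 1 / 2 + σ ≤ z.1 ∧ z.1 ≤ 1 ∧ 1 ≤ ⟪z.2, e⟫ ∧ ⟪z.2, e⟫ ≤ R₁ ∧
        4 * (Y₀ + 1) ^ 2 + 16 ≤ kA 1 z.1 * conePhi0 β η e z.2},
      Real.exp (2 * conePhi a β η e z) * ‖v z‖ ^ 2 ≤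
      Cχ * (31 * (Real.exp (a * (4 * (Y₀ + 1) ^ 2 + 16) + 2) *
        (Cd ^ 2 * (2 + 2 * (2 / (Real.exp 1 * (β' / 2))) ^ (2 : ℝ)) *
          ∫ z : ℝ × E, (Icc (1 / 2 : ℝ) 1).indicator (fun _ => (1 : ℝ)) z.1 *
            Real.exp (-(β' * ‖z.2‖ ^ 2))) + 1) + 6) := by
  -- ### the sets and constants
  set O : Set (ℝ × E) := Ioo (1 / 2 : ℝ) (3 / 2) ×ˢ D with hO
  have hOo : IsOpen O := isOpen_Ioo.prod hDo
  have hβ0 : 0 < β := by linarith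
  have hη0 : 0 ≤ η := by rw [hηε]; exact Real.rpow_nonneg hε0.le _
  have hη1 : η ≤ 1 := by rw [hηε]; exact Real.rpow_le_one hε0.le hε1 (by linarith)
  have ha0 : 0 ≤ a := by linarith
  obtain ⟨B, hBdef⟩ : ∃ B : ℝ, B = 4 * (Y₀ + 1) ^ 2 + 16 := ⟨_, rfl⟩
  have hB16 : 16 ≤ B := by rw [hBdef]; nlinarith
  have hBY : (Y₀ + 1) ^ 2 + 4 ≤ B / 4 := by rw [hBdef]; linarith
  have hB0 : 0 ≤ B := by linarith
  obtain ⟨Cq, hCq⟩ : ∃ Cq : ℝ, Cq = 2 + 2 * (2 / (Real.exp 1 * (β' / 2))) ^ (2 : ℝ) := ⟨_, rfl⟩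
  have hCq0 : 0 ≤ Cq := by rw [hCq]; positivity
  set Φ : ℝ × E → ℝ := fun z => (Icc (1 / 2 : ℝ) 1).indicator (fun _ => (1 : ℝ)) z.1 *
    Real.exp (-(β' * ‖z.2‖ ^ 2)) with hΦ
  have hΦi : Integrable Φ := integrable_majorant hβ'
  have hind01 : ∀ (T : Set ℝ) (x : ℝ), 0 ≤ T.indicator (fun _ => (1 : ℝ)) x ∧
      T.indicator (fun _ => (1 : ℝ)) x ≤ 1 := fun T x => by
    by_cases hx : x ∈ T
    · rw [Set.indicator_of_mem hx]; norm_num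
    · rw [Set.indicator_of_notMem hx]; norm_num
  have hΦ0 : ∀ z, 0 ≤ Φ z := fun z => mul_nonneg (hind01 _ _).1 (Real.exp_pos _).le
  set KM : ℝ := Cd ^ 2 * Cq * ∫ z, Φ z with hKM
  have hIΦ0 : 0 ≤ ∫ z, Φ z := integral_nonneg hΦ0
  have hKM0 : 0 ≤ KM := by positivity
  -- ### the choice of `R''`
  have hlimN := ((tendsto_setIntegral_yn_ge hΦi e).const_mul (Real.exp 2 * (Cd ^ 2 * Cq)))
  rw [mul_zero] at hlimN
  obtain ⟨RN, hRN⟩ := eventually_atTop.1 (hlimN.eventually_le_const zero_lt_one)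
  set Ra : ℝ := max 1 ((4 * a / β') ^ (2 - 2 * β)⁻¹) with hRa
  set R'' : ℝ := max (max (max R₁ (Y₀ + 1)) Ra) (max RN 2) with hR''
  have hR''R₁ : R₁ ≤ R'' := le_trans (le_trans (le_max_left _ _) (le_max_left _ _)) (le_max_left _ _)
  have hR''Y : Y₀ + 1 ≤ R'' := le_trans (le_trans (le_max_right _ _) (le_max_left _ _)) (le_max_left _ _)
  have hR''a : Ra ≤ R'' := le_trans (le_max_right _ _) (le_max_left _ _)
  have hR''N : RN ≤ R'' := le_trans (le_max_left _ _) (le_max_right _ _)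
  have hR''2 : 2 ≤ R'' := le_trans (le_max_right _ _) (le_max_right _ _)
  have hTN1 : Real.exp 2 * (Cd ^ 2 * Cq) * ∫ z in {z : ℝ × E | R'' ≤ ⟪z.2, e⟫}, Φ z ≤ 1 :=
    hRN R'' hR''N
  -- ### the spatial base of the box and the weight bound there
  set Bset : Set E := {y : E | 2 ≤ ⟪y, e⟫ ∧ ⟪y, e⟫ ≤ R'' + 1 ∧ B / 4 ≤ conePhi0 β η e y}
    with hBset
  have hce : Continuous fun y : E => ⟪y, e⟫ := continuous_id.inner continuous_const
  have hcφ : Continuous fun y : E => conePhi0 β η e y := continuous_conePhi0 hβ0 η e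
  have hBsetc : IsClosed Bset := (isClosed_le continuous_const hce).inter
    ((isClosed_le hce continuous_const).inter (isClosed_le continuous_const hcφ))
  have hBsetm : MeasurableSet Bset := hBsetc.measurableSet
  have hBsetcone : ∀ y ∈ Bset, ε * ‖y‖ < ⟪y, e⟫ := fun y hy =>
    cone_of_conePhi0_pos hβ0 hε0 hηε (by linarith [hy.1]) (by linarith [hy.2.2])
  have hBsetK : Bset ⊆ closedBall (0 : E) ((R'' + 1) / ε) := by
    intro y hy
    rw [mem_closedBall, dist_zero_right, le_div_iff₀ hε0, mul_comm]
    have h1 := hBsetcone y hy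
    linarith only [h1, hy.2.1]
  have hBsetb : Bornology.IsBounded Bset := isBounded_closedBall.subset hBsetK
  have hBsetcpt : IsCompact Bset := (isCompact_closedBall _ _).of_isClosed_subset hBsetc hBsetK
  have hBsetvol : volume Bset ≠ ∞ := (measure_mono hBsetK |>.trans_lt measure_closedBall_lt_top).ne
  have hBsetD : Bset ⊆ D := fun y hy => hD y (hBsetcone y hy) (by linarith [hy.1])
  set Wmax : ℝ := Real.exp 2 * Real.exp (2 * a * (R'' + 1) ^ 2) with hWmax
  have hWmax0 : 0 < Wmax := by positivity
  have hWle : ∀ z : ℝ × E, 1 / 2 ≤ z.1 → z.1 ≤ 1 → 1 ≤ ⟪z.2, e⟫ → ⟪z.2, e⟫ ≤ R'' + 1 →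
      0 ≤ conePhi0 β η e z.2 → Real.exp (2 * conePhi a β η e z) ≤ Wmax := by
    intro z hz1 hz2 hr1 hr2 hφ
    obtain ⟨h1, h2⟩ := cone_weight_le (a := a) (β := β) (η := η) (e := e) hz1 hz2 hφ
    refine h1.trans (mul_le_mul_of_nonneg_left ?_ (Real.exp_pos _).le)
    rw [Real.exp_le_exp]
    have h3 : conePhi0 β η e z.2 ≤ (R'' + 1) ^ 2 :=
      (conePhi0_le_inner_sq hβ1.le hη0 hr1).trans (pow_le_pow_left₀ (by linarith) hr2 2)
    have := mul_le_mul_of_nonneg_left (h2.trans h3) (by linarith : (0 : ℝ) ≤ 2 * a)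
    linarith
  -- ### the choice of `θ` (the initial layer)
  have hsubO : Ioo (1 / 2 : ℝ) (1 / 2 + 1 / 2) ×ˢ Bset ⊆ O := by
    rw [show (1 / 2 : ℝ) + 1 / 2 = 1 by norm_num]
    exact Set.prod_mono (Ioo_subset_Ioo_right (by norm_num)) hBsetD
  have hcontL : ContinuousOn v (Ico (1 / 2 : ℝ) (1 / 2 + 1 / 2) ×ˢ Bset) := by
    rw [show (1 / 2 : ℝ) + 1 / 2 = 1 by norm_num]
    exact hcont.mono (Set.prod_mono Ico_subset_Icc_self hBsetD)
  have h0L : ∀ y ∈ Bset, v (1 / 2, y) = 0 := fun y hy => h0 y (hBsetD hy)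
  have hfinL : ∫⁻ z in Ioo (1 / 2 : ℝ) (1 / 2 + 1 / 2) ×ˢ Bset, ‖dt v z‖ₑ ^ 2 < ∞ :=
    hH3 _ hsubO ((Metric.isBounded_Ioo _ _).prod hBsetb) (measurableSet_Ioo.prod hBsetm)
  have hε₁ : (0 : ℝ) < 1 / (9 * Wmax + 1) := by positivity
  obtain ⟨θ₀, hθ₀, hlayer⟩ := exists_layer_integral_le hOo hv hsubO hcontL h0L hBsetm hBsetvol
    (by norm_num : (0 : ℝ) < 1 / 2) hfinL hε₁
  set θ : ℝ := min (θ₀ / 3) (min (σ / 2) (1 / 8)) with hθ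
  have hθ0 : 0 < θ := lt_min (by linarith [hθ₀.1]) (lt_min (by linarith) (by norm_num))
  have hθ3 : 3 * θ ≤ θ₀ := by linarith [min_le_left (θ₀ / 3) (min (σ / 2) (1 / 8))]
  have hθσ : 2 * θ ≤ σ := by
    linarith [min_le_right (θ₀ / 3) (min (σ / 2) (1 / 8)), min_le_left (σ / 2) (1 / 8 : ℝ)]
  have hθ8 : θ ≤ 1 / 8 := le_trans (min_le_right _ _) (min_le_right _ _)
  have hlay : ∫ z in Ioo (1 / 2 : ℝ) (1 / 2 + 3 * θ) ×ˢ Bset, ‖v z‖ ^ 2 ≤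
      1 / (9 * Wmax + 1) * (3 * θ) ^ 2 := hlayer (3 * θ) ⟨by linarith, hθ3⟩
  -- ### the cut-off
  obtain ⟨χ, hχ2, hχc, hsupp, hχ0, hχ1, hplat, hPχ, hgχ⟩ := hχex B θ R'' hB16 hθ0 hθ8 hR''2
  set δ : ℝ := B / (32 * (R'' + 1) ^ 2) with hδ
  have hδ0 : 0 < δ := by rw [hδ]; exact div_pos (by linarith) (by positivity)
  set box : Set (ℝ × E) := Icc (1 / 2 + θ) (1 - δ) ×ˢ Bset with hbox
  have hsuppbox : tsupport χ ⊆ box := by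
    intro z hz
    obtain ⟨h1, -, h3, h4, h5⟩ := hsupp hz
    exact ⟨h1, h3, h4, h5⟩
  have hboxK : IsCompact box := isCompact_Icc.prod hBsetcpt
  have hboxm : MeasurableSet box := measurableSet_Icc.prod hBsetm
  have hboxO : box ⊆ O := by
    intro z hz
    exact ⟨⟨by linarith [hz.1.1], by linarith [hz.1.2]⟩, hBsetD hz.2⟩
  have hbox1 : ∀ z ∈ box, 1 / 2 ≤ z.1 ∧ z.1 < 1 ∧ 2 ≤ ⟪z.2, e⟫ ∧ ⟪z.2, e⟫ ≤ R'' + 1 ∧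
      B / 4 ≤ conePhi0 β η e z.2 ∧ ε * ‖z.2‖ < ⟪z.2, e⟫ := by
    intro z hz
    exact ⟨by linarith [hz.1.1], by linarith [hz.1.2], hz.2.1, hz.2.2.1, hz.2.2.2,
      hBsetcone z.2 hz.2⟩
  have hχs1 : tsupport χ ⊆ Ioo (1 / 2 : ℝ) 1 ×ˢ {x : E | ε * ‖x‖ < ⟪x, e⟫ ∧ 1 < ⟪x, e⟫} := by
    intro z hz
    have hb := hsuppbox hz
    obtain ⟨h1, h2, h3, -, -, h6⟩ := hbox1 z hb
    exact ⟨⟨by linarith [hb.1.1], h2⟩, h6, by show 1 < ⟪z.2, e⟫; linarith⟩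
  have hχsO : tsupport χ ⊆ O := hsuppbox.trans hboxO
  have hZ : ∀ z ∈ tsupport χ, 1 ≤ (8 * β ^ 2 * (1 - η) ^ 2 - 8 * β * η * (1 - η) -
      4 * β ^ 2 * η ^ 2) / 2 * a ^ 2 * kA 1 z.1 + a * conePhi0 β η e z.2 := by
    intro z hz
    obtain ⟨h1, h2, -, -, h5, -⟩ := hbox1 z (hsuppbox hz)
    have hk0 : 0 ≤ kA 1 z.1 := kA_one_nonneg (by linarith) h2.le
    have h3 : 0 ≤ (8 * β ^ 2 * (1 - η) ^ 2 - 8 * β * η * (1 - η) - 4 * β ^ 2 * η ^ 2) / 2 *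
        a ^ 2 * kA 1 z.1 := by positivity
    have h4 : 4 ≤ conePhi0 β η e z.2 := by linarith
    nlinarith only [h3, h4, ha1, mul_nonneg (sub_nonneg.2 ha1) (sub_nonneg.2 h4)]
  -- ### the set `G` and the cone Carleman inequality
  set G : Set (ℝ × E) := {z : ℝ × E | 1 / 2 + σ ≤ z.1 ∧ z.1 ≤ 1 ∧ 1 ≤ ⟪z.2, e⟫ ∧ ⟪z.2, e⟫ ≤ R₁ ∧
    4 * (Y₀ + 1) ^ 2 + 16 ≤ kA 1 z.1 * conePhi0 β η e z.2} with hG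
  have m1 : Measurable fun z : ℝ × E => z.1 := measurable_fst
  have m2 : Measurable fun z : ℝ × E => ⟪z.2, e⟫ := measurable_snd.inner measurable_const
  have hLm : Measurable fun z : ℝ × E => kA 1 z.1 * conePhi0 β η e z.2 := by
    have h1 : Measurable (kA 1) := by
      unfold kA; exact (measurable_id.pow_const _).sub (measurable_id.pow_const _)
    exact (h1.comp m1).mul (hcφ.measurable.comp measurable_snd)
  have hGm : MeasurableSet G := by
    simp only [hG, Set.setOf_and]
    exact (measurableSet_le measurable_const m1).inter ((measurableSet_le m1 measurable_const).inter
      ((measurableSet_le measurable_const m2).inter ((measurableSet_le m2 measurable_const).inter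
      (measurableSet_le measurable_const hLm))))
  have hG1 : ∀ z ∈ G, χ z = 1 := by
    intro z hz
    simp only [hG, mem_setOf_eq] at hz
    obtain ⟨hz1, hz2, hz3, hz4, hz5⟩ := hz
    exact hplat z (by linarith) hz2 hz3 (hz4.trans hR''R₁) (by rw [hBdef]; linarith)
  have hCarl := cone_carleman_smul_le_c12 hβ hβ1.le hε0.le hηε hκ hm hc₂ ha0 ha he hOo hv hvx hBH
    hc hχ2 hχc hχs1 hχsO hχ0 hZ hGm hG1
  -- ### the integrands
  set W : ℝ × E → ℝ := fun z => Real.exp (2 * conePhi a β η e z) with hW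
  have hW0 : ∀ z, 0 ≤ W z := fun z => (Real.exp_pos _).le
  set q : ℝ × E → ℝ := fun z => (1 + ‖z.2‖ ^ 2) ^ 2 with hq
  have hq0 : ∀ z, 0 ≤ q z := fun z => by positivity
  set f : ℝ × E → ℝ := fun z => W z * (q z * (‖v z‖ ^ 2 + gradSq v z)) with hf
  set g : ℝ × E → ℝ := fun z => W z * ‖v z‖ ^ 2 with hg
  have hf0 : ∀ z, 0 ≤ f z := fun z =>
    mul_nonneg (hW0 z) (mul_nonneg (hq0 z) (add_nonneg (sq_nonneg _) (gradSq_nonneg v z)))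
  have hg0 : ∀ z, 0 ≤ g z := fun z => mul_nonneg (hW0 z) (sq_nonneg _)
  have hgf : ∀ z, g z ≤ f z := by
    intro z
    have h1 : ‖v z‖ ^ 2 ≤ q z * (‖v z‖ ^ 2 + gradSq v z) := by
      have hq1 : 1 ≤ q z := by rw [hq]; nlinarith [sq_nonneg ‖z.2‖]
      have h2 := mul_le_mul hq1 (le_add_of_nonneg_right (gradSq_nonneg v z) : ‖v z‖ ^ 2 ≤ _)
        (sq_nonneg _) (hq0 z)
      linarith only [h2]
    exact mul_le_mul_of_nonneg_left h1 (hW0 z)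
  -- indicator values
  set M : Set (ℝ × E) := {z : ℝ × E | 0 < z.1 ∧ 0 < ⟪z.2, e⟫ ∧
    kA 1 z.1 * conePhi0 β η e z.2 ∈ Icc (B / 4) (B / 2)} with hM
  set iM : ℝ × E → ℝ := fun z => M.indicator (fun _ => (1 : ℝ)) z with hiM
  set iN : ℝ × E → ℝ := fun z => (Icc R'' (R'' + 1)).indicator (fun _ => (1 : ℝ)) ⟪z.2, e⟫ with hiN
  set iL : ℝ × E → ℝ := fun z => (Icc (1 / 2 + θ) (1 / 2 + 2 * θ)).indicator (fun _ => (1 : ℝ)) z.1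
    with hiL
  have hiM01 : ∀ z, 0 ≤ iM z ∧ iM z ≤ 1 := fun z => by
    by_cases hx : z ∈ M
    · rw [hiM]; dsimp only; rw [Set.indicator_of_mem hx]; norm_num
    · rw [hiM]; dsimp only; rw [Set.indicator_of_notMem hx]; norm_num
  have hiN01 : ∀ z, 0 ≤ iN z ∧ iN z ≤ 1 := fun z => hind01 _ _
  have hiL01 : ∀ z, 0 ≤ iL z ∧ iL z ≤ 1 := fun z => hind01 _ _
  have hMm : MeasurableSet M := by
    simp only [hM, Set.setOf_and]
    exact (measurableSet_lt measurable_const m1).inter ((measurableSet_lt measurable_const m2).inter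
      (measurableSet_Icc.preimage hLm |> fun h => h))
  have hiMm : Measurable iM := (measurable_const.indicator hMm)
  have hiNm : Measurable iN := (measurable_const.indicator measurableSet_Icc).comp m2
  have hiLm : Measurable iL := (measurable_const.indicator measurableSet_Icc).comp m1
  -- ### continuity and integrability on the box
  have hboxh : box ⊆ halfDom e := fun z hz => ⟨by linarith [hz.1.1], by
    show 0 < ⟪z.2, e⟫
    linarith [hz.2.1]⟩
  have cφ : ContinuousOn (conePhi a β η e) box := (contDiffOn_conePhi a β η e).continuousOn.mono hboxh
  have cW : ContinuousOn W box := (continuousOn_const.mul cφ).rexp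
  have cvO : ContinuousOn v O := hv.continuousOn
  have cgvO : ContinuousOn (gradSq v) O := continuousOn_gradSq_c1 hOo hv
  have cq : Continuous q := ((continuous_const.add ((continuous_snd.norm).pow 2)).pow 2)
  have cf : ContinuousOn f box :=
    cW.mul (cq.continuousOn.mul (((cvO.mono hboxO).norm.pow 2).add (cgvO.mono hboxO)))
  have cg : ContinuousOn g box := cW.mul ((cvO.mono hboxO).norm.pow 2)
  have if_ : IntegrableOn f box := cf.integrableOn_compact hboxK
  have ig_ : IntegrableOn g box := cg.integrableOn_compact hboxK
  have ibdd : ∀ {i : ℝ × E → ℝ}, Measurable i → (∀ z, 0 ≤ i z ∧ i z ≤ 1) → ∀ {h : ℝ × E → ℝ},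
      IntegrableOn h box → IntegrableOn (fun z => i z * h z) box := by
    intro i hi hi01 h hh
    refine Integrable.bdd_mul hh hi.aestronglyMeasurable (c := 1) (ae_of_all _ fun z => ?_)
    rw [Real.norm_eq_abs, abs_of_nonneg (hi01 z).1]; exact (hi01 z).2
  have iMf := ibdd hiMm hiM01 if_
  have iNf := ibdd hiNm hiN01 if_
  have iLg := ibdd hiLm hiL01 ig_
  -- χ-quantities vanish off the support and are continuous
  have hχd0 : ∀ z ∉ tsupport χ, fderiv ℝ χ z = 0 := fun z hz =>
    fderiv_of_notMem_tsupport (𝕜 := ℝ) hz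
  have hgχ0 : ∀ z ∉ tsupport χ, gradSq χ z = 0 := fun z hz => by simp [gradSq, dx, hχd0 z hz]
  have hlapχ0 : ∀ z ∉ tsupport χ, lap χ z = 0 := fun z hz =>
    image_eq_zero_of_notMem_tsupport fun h => hz (tsupport_lap_subset χ h)
  have hdtχ0 : ∀ z ∉ tsupport χ, dt χ z = 0 := fun z hz => by simp [dt, hχd0 z hz]
  have cfdr : ∀ u : ℝ × E, Continuous fun z => fderiv ℝ χ z u :=
    fun u => (hχ2.continuous_fderiv (by norm_num)).clm_apply continuous_const
  have cfd2r : ∀ u u' : ℝ × E, Continuous fun z => fderiv ℝ (fun y => fderiv ℝ χ y u) z u' := by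
    intro u u'
    have h1 : ContDiff ℝ 1 fun y => fderiv ℝ χ y u :=
      (hχ2.fderiv_right (m := 1) le_rfl).clm_apply contDiff_const
    exact (h1.continuous_fderiv one_ne_zero).clm_apply continuous_const
  have cPχ : Continuous fun z => dt χ z + lap χ z := by
    simp only [dt, lap, dx]
    exact (cfdr _).add (continuous_finsetSum _ fun i _ => cfd2r _ _)
  have cgχ : Continuous (gradSq χ) := by
    show Continuous fun z => gradSq χ z
    simp only [gradSq, dx]
    exact continuous_finsetSum _ fun i _ => ((cfdr _).norm.pow 2)
  -- ### from the `J`'s to the box integrals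
  set TM : ℝ := ∫ z in box, iM z * f z with hTM
  set TN : ℝ := ∫ z in box, iN z * f z with hTN
  set TL : ℝ := ∫ z in box, iL z * g z with hTL
  have hI0 : ∀ z, 0 ≤ iM z + iN z := fun z => by linarith [(hiM01 z).1, (hiN01 z).1]
  have iIf : IntegrableOn (fun z => (iM z + iN z) * f z) box := by
    have := iMf.add iNf
    refine this.congr (ae_of_all _ fun z => ?_)
    simp only [Pi.add_apply]; ring
  have hIT : ∫ z in box, (iM z + iN z) * f z = TM + TN := by
    have e1 : (fun z => (iM z + iN z) * f z) = fun z => iM z * f z + iN z * f z := by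
      funext z; ring
    rw [e1, integral_add iMf iNf]
  -- `J1 ≤ Cχ (TM + TN)`
  have hJ1 : ∫ z, W z * (gradSq χ z * ‖v z‖ ^ 2) ≤ Cχ * (TM + TN) := by
    have e1 : ∫ z, W z * (gradSq χ z * ‖v z‖ ^ 2) = ∫ z in box, W z * (gradSq χ z * ‖v z‖ ^ 2) :=
      (setIntegral_eq_integral_of_forall_compl_eq_zero fun z hz => by
        rw [hgχ0 z fun h => hz (hsuppbox h)]; simp).symm
    rw [e1, ← hIT, ← integral_const_mul]
    refine setIntegral_mono_on ?_ (iIf.const_mul _) hboxm fun z hz => ?_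
    · exact (cW.mul (cgχ.continuousOn.mul ((cvO.mono hboxO).norm.pow 2))).integrableOn_compact hboxK
    · have h1 := hgχ z
      have h2 : gradSq χ z * ‖v z‖ ^ 2 ≤ Cχ * (q z * (iM z + iN z)) * (‖v z‖ ^ 2 + gradSq v z) :=
        mul_le_mul h1 (by linarith [gradSq_nonneg v z]) (sq_nonneg _)
          (mul_nonneg hCχ.le (mul_nonneg (hq0 z) (hI0 z)))
      calc W z * (gradSq χ z * ‖v z‖ ^ 2)
          ≤ W z * (Cχ * (q z * (iM z + iN z)) * (‖v z‖ ^ 2 + gradSq v z)) :=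
            mul_le_mul_of_nonneg_left h2 (hW0 z)
        _ = Cχ * ((iM z + iN z) * f z) := by simp only [hf]; ring
  -- `J2 ≤ Cχ (θ⁻² TL + TM + TN)`
  have hJ2 : ∫ z, W z * ((dt χ z + lap χ z) ^ 2 * ‖v z‖ ^ 2) ≤
      Cχ * (θ⁻¹ ^ 2 * TL + (TM + TN)) := by
    have e1 : ∫ z, W z * ((dt χ z + lap χ z) ^ 2 * ‖v z‖ ^ 2) =
        ∫ z in box, W z * ((dt χ z + lap χ z) ^ 2 * ‖v z‖ ^ 2) :=
      (setIntegral_eq_integral_of_forall_compl_eq_zero fun z hz => by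
        rw [hdtχ0 z fun h => hz (hsuppbox h), hlapχ0 z fun h => hz (hsuppbox h)]; simp).symm
    have e2 : Cχ * (θ⁻¹ ^ 2 * TL + (TM + TN)) =
        ∫ z in box, Cχ * (θ⁻¹ ^ 2 * (iL z * g z) + (iM z + iN z) * f z) := by
      rw [integral_const_mul, integral_add (iLg.const_mul _) iIf, integral_const_mul, hIT]
    rw [e1, e2]
    refine setIntegral_mono_on ?_ (((iLg.const_mul _).add iIf).const_mul _) hboxm fun z hz => ?_
    · exact (cW.mul ((cPχ.pow 2).continuousOn.mul ((cvO.mono hboxO).norm.pow 2))).integrableOn_compact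
        hboxK
    · have h1 := hPχ z
      have hvv : ‖v z‖ ^ 2 ≤ ‖v z‖ ^ 2 + gradSq v z := by linarith [gradSq_nonneg v z]
      have hA : 0 ≤ θ⁻¹ ^ 2 * iL z := mul_nonneg (by positivity) (hiL01 z).1
      calc W z * ((dt χ z + lap χ z) ^ 2 * ‖v z‖ ^ 2)
          ≤ W z * (Cχ * (θ⁻¹ ^ 2 * iL z + q z * (iM z + iN z)) * ‖v z‖ ^ 2) :=
            mul_le_mul_of_nonneg_left (mul_le_mul_of_nonneg_right h1 (sq_nonneg _)) (hW0 z)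
        _ = Cχ * (θ⁻¹ ^ 2 * (iL z * g z) + (iM z + iN z) * (W z * (q z * ‖v z‖ ^ 2))) := by
            simp only [hg]; ring
        _ ≤ Cχ * (θ⁻¹ ^ 2 * (iL z * g z) + (iM z + iN z) * f z) := by
            refine mul_le_mul_of_nonneg_left (add_le_add le_rfl ?_) hCχ.le
            refine mul_le_mul_of_nonneg_left ?_ (hI0 z)
            exact mul_le_mul_of_nonneg_left (mul_le_mul_of_nonneg_left hvv (hq0 z)) (hW0 z)
  -- `J3 ≤ Cχ (TM + TN)`
  have hJ3 : ∫ z, W z * (gradSq χ z * gradSq v z) ≤ Cχ * (TM + TN) := by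
    have e1 : ∫ z, W z * (gradSq χ z * gradSq v z) = ∫ z in box, W z * (gradSq χ z * gradSq v z) :=
      (setIntegral_eq_integral_of_forall_compl_eq_zero fun z hz => by
        rw [hgχ0 z fun h => hz (hsuppbox h)]; simp).symm
    rw [e1, ← hIT, ← integral_const_mul]
    refine setIntegral_mono_on ?_ (iIf.const_mul _) hboxm fun z hz => ?_
    · exact (cW.mul (cgχ.continuousOn.mul (cgvO.mono hboxO))).integrableOn_compact hboxK
    · have h1 := hgχ z
      have h2 : gradSq χ z * gradSq v z ≤ Cχ * (q z * (iM z + iN z)) * (‖v z‖ ^ 2 + gradSq v z) :=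
        mul_le_mul h1 (by linarith [sq_nonneg ‖v z‖]) (gradSq_nonneg v z)
          (mul_nonneg hCχ.le (mul_nonneg (hq0 z) (hI0 z)))
      calc W z * (gradSq χ z * gradSq v z)
          ≤ W z * (Cχ * (q z * (iM z + iN z)) * (‖v z‖ ^ 2 + gradSq v z)) :=
            mul_le_mul_of_nonneg_left h2 (hW0 z)
        _ = Cχ * ((iM z + iN z) * f z) := by simp only [hf]; ring
  -- ### the box integrals
  have hboxfacts : ∀ z ∈ box, z ∈ O ∧ 1 / 2 ≤ z.1 ∧ z.1 ≤ 1 ∧ z.1 < 1 ∧ 2 ≤ ⟪z.2, e⟫ ∧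
      ⟪z.2, e⟫ ≤ R'' + 1 ∧ B / 4 ≤ conePhi0 β η e z.2 ∧ ε * ‖z.2‖ < ⟪z.2, e⟫ ∧
      z.1 ∈ Icc (1 / 2 : ℝ) 1 := by
    intro z hz
    obtain ⟨h1, h2, h3, h4, h5, h6⟩ := hbox1 z hz
    exact ⟨hboxO hz, h1, h2.le, h2, h3, h4, h5, h6, ⟨h1, h2.le⟩⟩
  have hΦbox : ∀ z ∈ box, Φ z = Real.exp (-(β' * ‖z.2‖ ^ 2)) := by
    intro z hz
    rw [hΦ]; dsimp only
    rw [Set.indicator_of_mem (hboxfacts z hz).2.2.2.2.2.2.2.2, one_mul]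
  have hfle : ∀ z ∈ box, f z ≤ Real.exp 2 * Real.exp (2 * a * (kA 1 z.1 * conePhi0 β η e z.2)) *
      (q z * (‖v z‖ ^ 2 + gradSq v z)) := by
    intro z hz
    obtain ⟨-, h1, h2, -, -, -, h5, -⟩ := hboxfacts z hz
    have hw := (cone_weight_le (a := a) (e := e) h1 h2 (by linarith)).1
    have h3 : 0 ≤ q z * (‖v z‖ ^ 2 + gradSq v z) :=
      mul_nonneg (hq0 z) (add_nonneg (sq_nonneg _) (gradSq_nonneg v z))
    exact mul_le_mul_of_nonneg_right hw h3
  -- decay applies on the box away from the layer: `⟪y, e⟫ ≥ Y₀ + 1`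
  have hrY : ∀ z ∈ box, Y₀ + 1 ≤ ⟪z.2, e⟫ := by
    intro z hz
    obtain ⟨-, -, -, -, h4, -, h6, -⟩ := hboxfacts z hz
    have h1 : conePhi0 β η e z.2 ≤ ⟪z.2, e⟫ ^ 2 := conePhi0_le_inner_sq hβ1.le hη0 (by linarith)
    by_contra hcon
    push Not at hcon
    have h2 : ⟪z.2, e⟫ ^ 2 < (Y₀ + 1) ^ 2 := pow_lt_pow_left₀ hcon (by linarith) two_ne_zero
    linarith only [h1, h2, h6, hBY]
  -- `TM ≤ e^{aB+2} KM`
  have hTM : TM ≤ Real.exp (a * B + 2) * KM := by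
    have hpt : ∀ z ∈ box, iM z * f z ≤ Real.exp (a * B + 2) * (Cd ^ 2 * Cq) * Φ z := by
      intro z hz
      obtain ⟨hzO, h1, h2, h3, h4, h5, h6, h7, h8⟩ := hboxfacts z hz
      by_cases hzM : z ∈ M
      · have hi : iM z = 1 := by rw [hiM]; dsimp only; rw [Set.indicator_of_mem hzM]
        rw [hi, one_mul, hΦbox z hz]
        obtain ⟨-, -, hk1, hk2⟩ := hzM
        have hd := hdec z hzO h3 h7 (by linarith [hrY z hz])
        have hmaj := cone_majorant_of_decay (X := 1) hβ' (Real.one_le_exp (by positivity)) hd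
        rw [one_mul, ← hCq] at hmaj
        have hexp : Real.exp 2 * Real.exp (2 * a * (kA 1 z.1 * conePhi0 β η e z.2)) ≤
            Real.exp (a * B + 2) := by
          rw [← Real.exp_add, Real.exp_le_exp]
          have := mul_le_mul_of_nonneg_left hk2 ha0
          linarith only [this]
        have hnn : 0 ≤ q z * (‖v z‖ ^ 2 + gradSq v z) :=
          mul_nonneg (hq0 z) (add_nonneg (sq_nonneg _) (gradSq_nonneg v z))
        calc f z ≤ Real.exp 2 * Real.exp (2 * a * (kA 1 z.1 * conePhi0 β η e z.2)) *
              (q z * (‖v z‖ ^ 2 + gradSq v z)) := hfle z hz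
          _ ≤ Real.exp (a * B + 2) * (Cd ^ 2 * Cq * Real.exp (-(β' * ‖z.2‖ ^ 2))) :=
              mul_le_mul hexp hmaj hnn (Real.exp_pos _).le
          _ = Real.exp (a * B + 2) * (Cd ^ 2 * Cq) * Real.exp (-(β' * ‖z.2‖ ^ 2)) := by ring
      · have hi : iM z = 0 := by rw [hiM]; dsimp only; rw [Set.indicator_of_notMem hzM]
        rw [hi, zero_mul]
        exact mul_nonneg (by positivity) (hΦ0 z)
    calc TM ≤ ∫ z in box, Real.exp (a * B + 2) * (Cd ^ 2 * Cq) * Φ z :=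
          setIntegral_mono_on iMf (hΦi.integrableOn.const_mul _) hboxm hpt
      _ = Real.exp (a * B + 2) * (Cd ^ 2 * Cq) * ∫ z in box, Φ z := integral_const_mul _ _
      _ ≤ Real.exp (a * B + 2) * (Cd ^ 2 * Cq) * ∫ z, Φ z := by
          refine mul_le_mul_of_nonneg_left ?_ (by positivity)
          exact setIntegral_le_integral hΦi (Eventually.of_forall hΦ0)
      _ = Real.exp (a * B + 2) * KM := by rw [hKM]; ring
  -- `TN ≤ 1`
  have hTN : TN ≤ 1 := by
    have hpt : ∀ z ∈ box, iN z * f z ≤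
        (Real.exp 2 * (Cd ^ 2 * Cq)) * ({z : ℝ × E | R'' ≤ ⟪z.2, e⟫}.indicator Φ z) := by
      intro z hz
      obtain ⟨hzO, h1, h2, h3, h4, h5, h6, h7, h8⟩ := hboxfacts z hz
      by_cases hzN : ⟪z.2, e⟫ ∈ Icc R'' (R'' + 1)
      · have hi : iN z = 1 := by rw [hiN]; dsimp only; rw [Set.indicator_of_mem hzN]
        have hmem : z ∈ {z : ℝ × E | R'' ≤ ⟪z.2, e⟫} := hzN.1
        rw [hi, one_mul, Set.indicator_of_mem hmem, hΦbox z hz]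
        have hd := hdec z hzO h3 h7 (by linarith [hrY z hz])
        -- `e^{2a k₁φ₀} ≤ e^{β'‖y‖²/2}` as `‖y‖ ≥ ⟪y,e⟫ ≥ R'' ≥ Ra`
        have hry : ⟪z.2, e⟫ ≤ ‖z.2‖ := by
          have := real_inner_le_norm z.2 e; rwa [he, mul_one] at this
        have hyR : Ra ≤ ‖z.2‖ := hR''a.trans (hzN.1.trans hry)
        have hgrow := two_mul_rpow_le_of_large hβ1 ha0 hβ' hyR
        have hL : kA 1 z.1 * conePhi0 β η e z.2 ≤ ‖z.2‖ ^ (2 * β) := by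
          have hk := (cone_weight_le (a := a) (e := e) h1 h2 (by linarith)).2
          refine hk.trans ?_
          have hφr : conePhi0 β η e z.2 ≤ ⟪z.2, e⟫ ^ (2 * β) := by
            rw [conePhi0]
            have : 0 ≤ η * (‖z.2‖ ^ 2) ^ β := mul_nonneg hη0 (Real.rpow_nonneg (by positivity) _)
            linarith
          exact hφr.trans (Real.rpow_le_rpow (by linarith) hry (by linarith))
        have hX : Real.exp (2 * a * (kA 1 z.1 * conePhi0 β η e z.2)) ≤
            Real.exp (β' / 2 * ‖z.2‖ ^ 2) := by
          rw [Real.exp_le_exp]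
          have := mul_le_mul_of_nonneg_left hL (by linarith : (0 : ℝ) ≤ 2 * a)
          linarith only [this, hgrow]
        have hmaj := cone_majorant_of_decay hβ' hX hd
        rw [← hCq] at hmaj
        calc f z ≤ Real.exp 2 * Real.exp (2 * a * (kA 1 z.1 * conePhi0 β η e z.2)) *
              (q z * (‖v z‖ ^ 2 + gradSq v z)) := hfle z hz
          _ = Real.exp 2 * (Real.exp (2 * a * (kA 1 z.1 * conePhi0 β η e z.2)) *
              (q z * (‖v z‖ ^ 2 + gradSq v z))) := by ring
          _ ≤ Real.exp 2 * (Cd ^ 2 * Cq * Real.exp (-(β' * ‖z.2‖ ^ 2))) :=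
              mul_le_mul_of_nonneg_left hmaj (Real.exp_pos _).le
          _ = Real.exp 2 * (Cd ^ 2 * Cq) * Real.exp (-(β' * ‖z.2‖ ^ 2)) := by ring
      · have hi : iN z = 0 := by rw [hiN]; dsimp only; rw [Set.indicator_of_notMem hzN]
        rw [hi, zero_mul]
        exact mul_nonneg (by positivity) (Set.indicator_nonneg (fun _ _ => hΦ0 _) _)
    have hmsN : MeasurableSet {z : ℝ × E | R'' ≤ ⟪z.2, e⟫} := measurableSet_le measurable_const m2
    calc TN ≤ ∫ z in box, (Real.exp 2 * (Cd ^ 2 * Cq)) * ({z : ℝ × E | R'' ≤ ⟪z.2, e⟫}.indicator Φ z) :=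
          setIntegral_mono_on iNf ((hΦi.indicator hmsN).integrableOn.const_mul _) hboxm hpt
      _ = (Real.exp 2 * (Cd ^ 2 * Cq)) * ∫ z in box, {z : ℝ × E | R'' ≤ ⟪z.2, e⟫}.indicator Φ z :=
          integral_const_mul _ _
      _ ≤ (Real.exp 2 * (Cd ^ 2 * Cq)) * ∫ z, {z : ℝ × E | R'' ≤ ⟪z.2, e⟫}.indicator Φ z := by
          refine mul_le_mul_of_nonneg_left ?_ (by positivity)
          exact setIntegral_le_integral (hΦi.indicator hmsN)
            (Eventually.of_forall fun z => Set.indicator_nonneg (fun _ _ => hΦ0 _) _)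
      _ = (Real.exp 2 * (Cd ^ 2 * Cq)) * ∫ z in {z : ℝ × E | R'' ≤ ⟪z.2, e⟫}, Φ z := by
          rw [integral_indicator hmsN]
      _ ≤ 1 := hTN1
  -- `θ⁻² TL ≤ 1`
  have hTL : θ⁻¹ ^ 2 * TL ≤ 1 := by
    set Lay : Set (ℝ × E) := Ioo (1 / 2 : ℝ) (1 / 2 + 3 * θ) ×ˢ Bset with hLay
    have hLaym : MeasurableSet Lay := measurableSet_Ioo.prod hBsetm
    have hLayK : Lay ⊆ Icc (1 / 2 : ℝ) 1 ×ˢ Bset :=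
      Set.prod_mono (fun s hs => ⟨hs.1.le, by linarith [hs.2, hθ8]⟩) Subset.rfl
    have hvLay : IntegrableOn (fun z => ‖v z‖ ^ 2) Lay :=
      (((hcont.mono (Set.prod_mono Subset.rfl hBsetD)).norm.pow 2).integrableOn_compact
        (isCompact_Icc.prod hBsetcpt)).mono_set hLayK
    have hpt : ∀ z ∈ box, iL z * g z ≤ Wmax * (Lay.indicator (fun z => ‖v z‖ ^ 2) z) := by
      intro z hz
      obtain ⟨hzO, h1, h2, h3, h4, h5, h6, h7, h8⟩ := hboxfacts z hz
      by_cases hzL : z.1 ∈ Icc (1 / 2 + θ) (1 / 2 + 2 * θ)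
      · have hi : iL z = 1 := by rw [hiL]; dsimp only; rw [Set.indicator_of_mem hzL]
        have hmem : z ∈ Lay := ⟨⟨by linarith [hzL.1], by linarith [hzL.2]⟩, hz.2⟩
        rw [hi, one_mul, Set.indicator_of_mem hmem]
        exact mul_le_mul_of_nonneg_right (hWle z h1 h2 (by linarith) h5 (by linarith)) (sq_nonneg _)
      · have hi : iL z = 0 := by rw [hiL]; dsimp only; rw [Set.indicator_of_notMem hzL]
        rw [hi, zero_mul]
        exact mul_nonneg hWmax0.le (Set.indicator_nonneg (fun _ _ => sq_nonneg _) _)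
    have h1 : TL ≤ Wmax * ∫ z in Lay, ‖v z‖ ^ 2 := by
      calc TL ≤ ∫ z in box, Wmax * (Lay.indicator (fun z => ‖v z‖ ^ 2) z) :=
            setIntegral_mono_on iLg (((hvLay.integrable_indicator hLaym).integrableOn).const_mul _)
              hboxm hpt
        _ = Wmax * ∫ z in box, Lay.indicator (fun z => ‖v z‖ ^ 2) z := integral_const_mul _ _
        _ ≤ Wmax * ∫ z, Lay.indicator (fun z => ‖v z‖ ^ 2) z := by
            refine mul_le_mul_of_nonneg_left ?_ hWmax0.le
            exact setIntegral_le_integral (hvLay.integrable_indicator hLaym)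
              (Eventually.of_forall fun z => Set.indicator_nonneg (fun _ _ => sq_nonneg _) _)
        _ = Wmax * ∫ z in Lay, ‖v z‖ ^ 2 := by rw [integral_indicator hLaym]
    have h2 : θ⁻¹ ^ 2 * (Wmax * (1 / (9 * Wmax + 1) * (3 * θ) ^ 2)) ≤ 1 := by
      have e : θ⁻¹ ^ 2 * (Wmax * (1 / (9 * Wmax + 1) * (3 * θ) ^ 2)) = 9 * Wmax / (9 * Wmax + 1) := by
        field_simp
        ring
      rw [e, div_le_one (by positivity)]
      linarith
    calc θ⁻¹ ^ 2 * TL ≤ θ⁻¹ ^ 2 * (Wmax * (1 / (9 * Wmax + 1) * (3 * θ) ^ 2)) := by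
          refine mul_le_mul_of_nonneg_left (h1.trans ?_) (by positivity)
          exact mul_le_mul_of_nonneg_left hlay hWmax0.le
      _ ≤ 1 := h2
  -- ### conclusion
  have hT0 : ∀ {i : ℝ × E → ℝ}, (∀ z, 0 ≤ i z ∧ i z ≤ 1) → ∀ {h : ℝ × E → ℝ}, (∀ z, 0 ≤ h z) →
      0 ≤ ∫ z in box, i z * h z := by
    intro i hi h hh
    exact setIntegral_nonneg hboxm fun z _ => mul_nonneg (hi z).1 (hh z)
  have hTM0 : 0 ≤ TM := hT0 hiM01 hf0
  have hTN0 : 0 ≤ TN := hT0 hiN01 hf0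
  have hTL0 : 0 ≤ TL := hT0 hiL01 hg0
  have hsum : (∫ z, W z * (gradSq χ z * ‖v z‖ ^ 2)) +
      6 * (∫ z, W z * ((dt χ z + lap χ z) ^ 2 * ‖v z‖ ^ 2)) +
      24 * (∫ z, W z * (gradSq χ z * gradSq v z)) ≤
      Cχ * (31 * (TM + TN) + 6 * (θ⁻¹ ^ 2 * TL)) := by
    linarith only [hJ1, hJ2, hJ3]
  have hbd : 31 * (TM + TN) + 6 * (θ⁻¹ ^ 2 * TL) ≤ 31 * (Real.exp (a * B + 2) * KM + 1) + 6 := by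
    linarith only [hTM, hTN, hTL]
  have hfinal : ∫ z in G, W z * ‖v z‖ ^ 2 ≤ Cχ * (31 * (Real.exp (a * B + 2) * KM + 1) + 6) :=
    (hCarl.trans hsum).trans (mul_le_mul_of_nonneg_left hbd hCχ.le)
  rw [hKM, hCq, hBdef] at hfinal
  exact hfinal


/-! ### Vanishing above the level set -/

set_option maxHeartbeats 1600000 in
/-- **Li–Šverák 2012, Lemma 2.4, the Carleman step** ("Passing to the limit as `a → ∞` we see
that `v(y, s) = 0` for `1/2 < s < 1` and `φ_B(y, s) > 0`"), in the class `C¹₂` and for the tree's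
weight: under the hypotheses of `cone_vanish_core_c12` on `v` (backward heat inequality with
`c² ≤ 1/96` on `]1/2, 3/2[ × D`, `D ⊇ {ε‖y‖ < ⟪y,e⟫, ⟪y,e⟫ > 1}` open, vanishing continuously
on `s = 1/2`, `∂ₛv` locally square integrable, the decay (2.13) for `⟪y, e⟫ ≥ Y₀` in the cone)
and on the parameters `β < 1`, `ε`, `η = ε^{2β}` of the cone Carleman inequality,
`v(s, y) = 0` whenever `1/2 < s < 1`, `ε‖y‖ < ⟪y,e⟫`, `⟪y,e⟫ > 1` and
`k₁(s)φ₀(y) > 4(Y₀+1)² + 16`. [cite: LiSverak2012, Lemma 2.4 and its proof] -/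
theorem cone_vanish_of_carleman_c12 {v : ℝ × E → F} {e : E} {D : Set E}
    {β ε η c Cd β' Y₀ : ℝ} (he : ‖e‖ = 1)
    (hβ : 1 / 2 < β) (hβ1 : β < 1) (hε0 : 0 < ε) (hε1 : ε ≤ 1) (hηε : η = ε ^ (2 * β))
    (hκ : 0 ≤ 2 * β - 1 - 2 * η)
    (hm : 0 ≤ (2 * β - 1 - 2 * η) * (1 - η) ^ 2 - 2 * η * ε ^ 2 * (1 - ε ^ 2))
    (hc₂ : 0 < 8 * β ^ 2 * (1 - η) ^ 2 - 8 * β * η * (1 - η) - 4 * β ^ 2 * η ^ 2)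
    (hc : c ^ 2 ≤ 1 / 96) (hβ' : 0 < β')
    (hDo : IsOpen D) (hD : ∀ y : E, ε * ‖y‖ < ⟪y, e⟫ → 1 < ⟪y, e⟫ → y ∈ D)
    (hv : ContDiffOn ℝ 1 v (Ioo (1 / 2 : ℝ) (3 / 2) ×ˢ D))
    (hvx : ∀ e' : E, ContDiffOn ℝ 1 (dx e' v) (Ioo (1 / 2 : ℝ) (3 / 2) ×ˢ D))
    (hBH : ∀ z ∈ Ioo (1 / 2 : ℝ) (3 / 2) ×ˢ D,
      ‖dt v z + lap v z‖ ≤ c * (‖v z‖ + Real.sqrt (gradSq v z)))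
    (hcont : ContinuousOn v (Icc (1 / 2 : ℝ) 1 ×ˢ D))
    (h0 : ∀ y ∈ D, v (1 / 2, y) = 0)
    (hH3 : ∀ K ⊆ Ioo (1 / 2 : ℝ) (3 / 2) ×ˢ D, Bornology.IsBounded K →
      MeasurableSet K → ∫⁻ z in K, ‖dt v z‖ₑ ^ 2 < ∞)
    (hdec : ∀ z ∈ Ioo (1 / 2 : ℝ) (3 / 2) ×ˢ D, z.1 < 1 → ε * ‖z.2‖ < ⟪z.2, e⟫ → Y₀ ≤ ⟪z.2, e⟫ →
      ‖v z‖ + Real.sqrt (gradSq v z) ≤ Cd * Real.exp (-(β' * ‖z.2‖ ^ 2))) :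
    ∀ z ∈ Ioo (1 / 2 : ℝ) (3 / 2) ×ˢ D, z.1 < 1 → ε * ‖z.2‖ < ⟪z.2, e⟫ → 1 < ⟪z.2, e⟫ →
      4 * (Y₀ + 1) ^ 2 + 16 < kA 1 z.1 * conePhi0 β η e z.2 → v z = 0 := by
  obtain ⟨Cχ, hCχ, hχex0⟩ := exists_cone_cutoff (E := E)
  have hχex := fun B θ R'' (hB : 16 ≤ B) (hθ : 0 < θ) (hθ1 : θ ≤ 1 / 8) (hR : 2 ≤ R'') =>
    hχex0 e he β ε η B θ R'' hβ hβ1.le hε0 hε1 hηε hB hθ hθ1 hR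
  obtain ⟨B, hBdef⟩ : ∃ B : ℝ, B = 4 * (Y₀ + 1) ^ 2 + 16 := ⟨_, rfl⟩
  have hB0 : 0 < B := by rw [hBdef]; positivity
  have hB16 : 16 ≤ B := by rw [hBdef]; nlinarith [sq_nonneg (Y₀ + 1)]
  have hβ0 : 0 < β := by linarith
  have hη0 : 0 ≤ η := by rw [hηε]; exact Real.rpow_nonneg hε0.le _
  set O : Set (ℝ × E) := Ioo (1 / 2 : ℝ) (3 / 2) ×ˢ D with hO
  have hOo : IsOpen O := isOpen_Ioo.prod hDo
  set c₂' : ℝ := 8 * β ^ 2 * (1 - η) ^ 2 - 8 * β * η * (1 - η) - 4 * β ^ 2 * η ^ 2 with hc₂'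
  set KM : ℝ := Cd ^ 2 * (2 + 2 * (2 / (Real.exp 1 * (β' / 2))) ^ (2 : ℝ)) *
    ∫ z : ℝ × E, (Icc (1 / 2 : ℝ) 1).indicator (fun _ => (1 : ℝ)) z.1 *
      Real.exp (-(β' * ‖z.2‖ ^ 2)) with hKM
  have hKM0 : 0 ≤ KM := by
    rw [hKM]
    refine mul_nonneg (by positivity) (integral_nonneg fun z => ?_)
    exact mul_nonneg (Set.indicator_nonneg (fun _ _ => zero_le_one) _) (Real.exp_pos _).le
  -- the threshold for `a`
  set a₀ : ℝ := max 1 (2 * ((1 - β) * (9 * ((Module.finrank ℝ E : ℝ) + 4) ^ 2)) / c₂') with ha₀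
  have ha₀1 : 1 ≤ a₀ := le_max_left _ _
  have ha₀2 : ∀ a, a₀ ≤ a → 2 * ((1 - β) * (9 * ((Module.finrank ℝ E : ℝ) + 4) ^ 2)) ≤ a * c₂' := by
    intro a ha
    have h1 : 2 * ((1 - β) * (9 * ((Module.finrank ℝ E : ℝ) + 4) ^ 2)) / c₂' ≤ a :=
      le_trans (le_max_right _ _) ha
    rw [div_le_iff₀ hc₂] at h1
    exact h1
  -- the facts on the level set `{k₁φ₀ ≥ B}`
  have hfacts : ∀ z : ℝ × E, 1 / 2 ≤ z.1 → z.1 ≤ 1 → 0 < ⟪z.2, e⟫ →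
      B ≤ kA 1 z.1 * conePhi0 β η e z.2 →
      z.1 < 1 ∧ 2 < ⟪z.2, e⟫ ∧ B ≤ conePhi0 β η e z.2 ∧ ε * ‖z.2‖ < ⟪z.2, e⟫ := by
    intro z hz1 hz2 hr hL
    have hs1 : z.1 < 1 := by
      rcases lt_or_eq_of_le hz2 with h | h
      · exact h
      · exfalso
        have : kA 1 z.1 = 0 := by rw [h, kA_one_eq one_pos]; simp
        rw [this, zero_mul] at hL
        linarith
    obtain ⟨hk0, hk1, -⟩ := kA_one_facts hz1 hz2
    obtain ⟨hφ4, hr2, -⟩ := facts_of_coneLevel_gt (R := max 1 ⟪z.2, e⟫) hβ hβ1.le hη0 hB16 hz1 hs1 hr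
      (le_max_left _ _) (le_max_right _ _) (by linarith : B / 4 < kA 1 z.1 * conePhi0 β η e z.2)
    have hφ0 : 0 ≤ conePhi0 β η e z.2 := by linarith
    have hkφ : kA 1 z.1 * conePhi0 β η e z.2 ≤ conePhi0 β η e z.2 := by
      calc kA 1 z.1 * conePhi0 β η e z.2 ≤ 1 * conePhi0 β η e z.2 :=
            mul_le_mul_of_nonneg_right hk1 hφ0
        _ = _ := one_mul _
    exact ⟨hs1, hr2, hL.trans hkφ, cone_of_conePhi0_pos hβ0 hε0 hηε hr (by linarith)⟩
  -- ### Step 1: `∫_G |v|² = 0` on the sets `G(σ, R₁)`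
  have hzero : ∀ σ R₁ : ℝ, 0 < σ → σ ≤ 1 / 4 → 1 ≤ R₁ →
      IntegrableOn (fun z => ‖v z‖ ^ 2) {z : ℝ × E | 1 / 2 + σ ≤ z.1 ∧ z.1 ≤ 1 ∧ 1 ≤ ⟪z.2, e⟫ ∧
        ⟪z.2, e⟫ ≤ R₁ ∧ 4 * (Y₀ + 1) ^ 2 + 16 ≤ kA 1 z.1 * conePhi0 β η e z.2} ∧
      ∫ z in {z : ℝ × E | 1 / 2 + σ ≤ z.1 ∧ z.1 ≤ 1 ∧ 1 ≤ ⟪z.2, e⟫ ∧ ⟪z.2, e⟫ ≤ R₁ ∧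
        4 * (Y₀ + 1) ^ 2 + 16 ≤ kA 1 z.1 * conePhi0 β η e z.2}, ‖v z‖ ^ 2 = 0 := by
    intro σ R₁ hσ hσ1 hR₁
    set G : Set (ℝ × E) := {z : ℝ × E | 1 / 2 + σ ≤ z.1 ∧ z.1 ≤ 1 ∧ 1 ≤ ⟪z.2, e⟫ ∧ ⟪z.2, e⟫ ≤ R₁ ∧
        4 * (Y₀ + 1) ^ 2 + 16 ≤ kA 1 z.1 * conePhi0 β η e z.2} with hG
    -- `G` lies in a compact subset of the region of continuity
    set K₂ : Set E := {y : E | 2 ≤ ⟪y, e⟫ ∧ ⟪y, e⟫ ≤ R₁ ∧ B ≤ conePhi0 β η e y} with hK₂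
    set KG : Set (ℝ × E) := Icc (1 / 2 + σ) 1 ×ˢ K₂ with hKG
    have hce : Continuous fun y : E => ⟪y, e⟫ := continuous_id.inner continuous_const
    have hcφ : Continuous fun y : E => conePhi0 β η e y := continuous_conePhi0 hβ0 η e
    have hK₂c : IsClosed K₂ := (isClosed_le continuous_const hce).inter
      ((isClosed_le hce continuous_const).inter (isClosed_le continuous_const hcφ))
    have hK₂cone : ∀ y ∈ K₂, ε * ‖y‖ < ⟪y, e⟫ := fun y hy =>
      cone_of_conePhi0_pos hβ0 hε0 hηε (by linarith [hy.1]) (by linarith [hy.2.2])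
    have hK₂K : K₂ ⊆ closedBall (0 : E) (R₁ / ε) := by
      intro y hy
      rw [mem_closedBall, dist_zero_right, le_div_iff₀ hε0, mul_comm]
      linarith only [hK₂cone y hy, hy.2.1]
    have hK₂cpt : IsCompact K₂ := (isCompact_closedBall _ _).of_isClosed_subset hK₂c hK₂K
    have hK₂D : K₂ ⊆ D := fun y hy => hD y (hK₂cone y hy) (by linarith [hy.1])
    have hKGc : IsCompact KG := isCompact_Icc.prod hK₂cpt
    have hGKG : G ⊆ KG := by
      intro z hz
      obtain ⟨h1, h2, h3, h4, h5⟩ := hz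
      obtain ⟨-, hr2, hφB, -⟩ := hfacts z (by linarith) h2 (by linarith) (by rw [hBdef]; exact h5)
      exact ⟨⟨h1, h2⟩, hr2.le, h4, hφB⟩
    have hKGc' : KG ⊆ Icc (1 / 2 : ℝ) 1 ×ˢ D := by
      intro z hz
      exact ⟨⟨by linarith [hz.1.1], hz.1.2⟩, hK₂D hz.2⟩
    have hvG : IntegrableOn (fun z => ‖v z‖ ^ 2) G :=
      (((hcont.mono hKGc').norm.pow 2).integrableOn_compact hKGc).mono_set hGKG
    refine ⟨hvG, ?_⟩
    have hI0 : 0 ≤ ∫ z in G, ‖v z‖ ^ 2 := integral_nonneg fun z => sq_nonneg _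
    -- measurability of `G`
    have m1 : Measurable fun z : ℝ × E => z.1 := measurable_fst
    have m2 : Measurable fun z : ℝ × E => ⟪z.2, e⟫ := measurable_snd.inner measurable_const
    have hLm : Measurable fun z : ℝ × E => kA 1 z.1 * conePhi0 β η e z.2 := by
      have h1 : Measurable (kA 1) := by
        unfold kA; exact (measurable_id.pow_const _).sub (measurable_id.pow_const _)
      exact (h1.comp m1).mul (hcφ.measurable.comp measurable_snd)
    have hGm : MeasurableSet G := by
      simp only [hG, Set.setOf_and]
      exact (measurableSet_le measurable_const m1).inter ((measurableSet_le m1 measurable_const).inter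
        ((measurableSet_le measurable_const m2).inter ((measurableSet_le m2 measurable_const).inter
        (measurableSet_le measurable_const hLm))))
    have hKGh : KG ⊆ halfDom e := fun z hz => ⟨by linarith [hz.1.1], by
      have h1 : 2 ≤ ⟪z.2, e⟫ := hz.2.1
      show 0 < ⟪z.2, e⟫
      linarith⟩
    -- ### the bound for every `a ≥ a₀`
    have hbound : ∀ a : ℝ, a₀ ≤ a → ∫ z in G, ‖v z‖ ^ 2 ≤
        Cχ * (31 * Real.exp 2 * KM * Real.exp (-(a * B)) + 37 * Real.exp (-(2 * a * B))) := by
      intro a ha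
      have ha1 : 1 ≤ a := le_trans ha₀1 ha
      have ha0 : 0 ≤ a := by linarith
      have hcore := cone_vanish_core_c12 (D := D) (Cd := Cd) (Y₀ := Y₀) he hβ hβ1 hε0 hε1 hηε hκ hm
        hc₂ ha1 (ha₀2 a ha) hc hβ' hCχ hχex hDo hD hv hvx hBH hcont h0 hH3 hdec hσ hσ1 hR₁
      set W : ℝ × E → ℝ := fun z => Real.exp (2 * conePhi a β η e z) with hW
      have hcore' : ∫ z in G, W z * ‖v z‖ ^ 2 ≤ Cχ * (31 * (Real.exp (a * B + 2) * KM + 1) + 6) := by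
        rw [hBdef, hKM]; exact hcore
      -- lower bound of the weight on `G`
      set μ : ℝ := Real.exp (2 * a * B) with hμ
      have hμ0 : 0 < μ := Real.exp_pos _
      have hlow : ∀ z ∈ G, μ * ‖v z‖ ^ 2 ≤ W z * ‖v z‖ ^ 2 := by
        intro z hz
        obtain ⟨h1, h2, h3, h4, h5⟩ := hz
        refine mul_le_mul_of_nonneg_right ?_ (sq_nonneg _)
        rw [hμ, hW, Real.exp_le_exp, conePhi]
        have h6 : B ≤ kA 1 z.1 * conePhi0 β η e z.2 := by rw [hBdef]; exact h5
        have h7 := mul_le_mul_of_nonneg_left h6 ha0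
        nlinarith only [h7, sq_nonneg z.1]
      have cφ : ContinuousOn (conePhi a β η e) KG := (contDiffOn_conePhi a β η e).continuousOn.mono hKGh
      have cW : ContinuousOn W KG := (continuousOn_const.mul cφ).rexp
      have hWvG : IntegrableOn (fun z => W z * ‖v z‖ ^ 2) G :=
        ((cW.mul ((hcont.mono hKGc').norm.pow 2)).integrableOn_compact hKGc).mono_set hGKG
      have h1 : μ * ∫ z in G, ‖v z‖ ^ 2 ≤ ∫ z in G, W z * ‖v z‖ ^ 2 := by
        rw [← integral_const_mul]
        exact setIntegral_mono_on (hvG.const_mul _) hWvG hGm hlow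
      have h2 := h1.trans hcore'
      have hμ' : μ⁻¹ = Real.exp (-(2 * a * B)) := by rw [hμ, ← Real.exp_neg]
      have h3 : ∫ z in G, ‖v z‖ ^ 2 ≤ μ⁻¹ * (Cχ * (31 * (Real.exp (a * B + 2) * KM + 1) + 6)) := by
        rw [le_inv_mul_iff₀ hμ0]; exact h2
      refine h3.trans (le_of_eq ?_)
      rw [hμ']
      have e3 : Real.exp (-(2 * a * B)) * Real.exp (a * B + 2) = Real.exp 2 * Real.exp (-(a * B)) := by
        rw [← Real.exp_add, ← Real.exp_add]; congr 1; ring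
      calc Real.exp (-(2 * a * B)) * (Cχ * (31 * (Real.exp (a * B + 2) * KM + 1) + 6))
          = Cχ * (31 * KM * (Real.exp (-(2 * a * B)) * Real.exp (a * B + 2)) +
            37 * Real.exp (-(2 * a * B))) := by ring
        _ = _ := by rw [e3]; ring
    -- ### the limit `a → ∞`
    have hlim : Tendsto (fun a : ℝ => Cχ * (31 * Real.exp 2 * KM * Real.exp (-(a * B)) +
        37 * Real.exp (-(2 * a * B)))) atTop (𝓝 0) := by
      have h1 : Tendsto (fun a : ℝ => Real.exp (-(a * B))) atTop (𝓝 0) :=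
        Real.tendsto_exp_neg_atTop_nhds_zero.comp (tendsto_id.atTop_mul_const hB0)
      have h2 : Tendsto (fun a : ℝ => Real.exp (-(2 * a * B))) atTop (𝓝 0) := by
        have h3 : Tendsto (fun a : ℝ => 2 * a * B) atTop atTop :=
          (tendsto_id.const_mul_atTop (by norm_num : (0 : ℝ) < 2)).atTop_mul_const hB0
        exact Real.tendsto_exp_neg_atTop_nhds_zero.comp h3
      have h4 := ((h1.const_mul (31 * Real.exp 2 * KM)).add (h2.const_mul 37)).const_mul Cχ
      rw [mul_zero, mul_zero, add_zero, mul_zero] at h4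
      exact h4
    refine le_antisymm ?_ hI0
    refine le_of_forall_pos_le_add fun ε' hε' => ?_
    obtain ⟨a₁, ha₁⟩ := eventually_atTop.1 (hlim.eventually_le_const hε')
    have h1 := hbound (max a₁ a₀) (le_max_right _ _)
    have h2 := ha₁ (max a₁ a₀) (le_max_left _ _)
    linarith
  -- ### Step 2: pointwise vanishing
  intro z hz hs1 hcone hr1 hk
  have hzO : z ∈ O := hz
  obtain ⟨⟨hs0, -⟩, hyD⟩ := hz
  have hyr : 0 < ⟪z.2, e⟫ := by linarith
  by_contra hne
  have hvz : 0 < ‖v z‖ := norm_pos_iff.2 hne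
  -- parameters `σ`, `R₁`
  set σ : ℝ := min ((z.1 - 1 / 2) / 2) (1 / 4) with hσ
  have hσ0 : 0 < σ := lt_min (by linarith) (by norm_num)
  have hσ1 : σ ≤ 1 / 4 := min_le_right _ _
  have hσs : σ ≤ (z.1 - 1 / 2) / 2 := min_le_left _ _
  set R₁ : ℝ := ‖z.2‖ + 2 with hR₁
  have hR₁1 : 1 ≤ R₁ := by rw [hR₁]; linarith [norm_nonneg z.2]
  obtain ⟨hvG, hG0⟩ := hzero σ R₁ hσ0 hσ1 hR₁1
  -- continuity of `k₁φ₀` and of `v` at `z`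
  have hkcont : ContinuousAt (fun w : ℝ × E => kA 1 w.1 * conePhi0 β η e w.2) z := by
    have h1 : ContinuousAt (kA 1) z.1 :=
      (contDiffOn_kA _).continuousOn.continuousAt (isOpen_Ioi.mem_nhds (by linarith : (0 : ℝ) < z.1))
    have h5 : ContinuousAt (fun w : ℝ × E => kA 1 w.1) z :=
      ContinuousAt.comp (f := fun w : ℝ × E => w.1) h1 continuousAt_fst
    have h4 : ContinuousAt (fun w : ℝ × E => conePhi0 β η e w.2) z :=
      ((continuous_conePhi0 hβ0 η e).comp continuous_snd).continuousAt
    exact h5.mul h4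
  have hev1 : ∀ᶠ w in 𝓝 z, 4 * (Y₀ + 1) ^ 2 + 16 < kA 1 w.1 * conePhi0 β η e w.2 :=
    hkcont.eventually (lt_mem_nhds hk)
  obtain ⟨r₁, hr₁, hr₁'⟩ := Metric.eventually_nhds_iff.1 hev1
  have hvcont : ContinuousAt v z := hv.continuousOn.continuousAt (hOo.mem_nhds hzO)
  obtain ⟨r₂, hr₂, hr₂'⟩ := Metric.continuousAt_iff.1 hvcont (‖v z‖ / 2) (by positivity)
  set r : ℝ := min (min r₁ r₂) (min ((z.1 - 1 / 2) / 2) (min ((1 - z.1) / 2) (min 1 (⟪z.2, e⟫ - 1))))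
    with hr
  have hr0 : 0 < r := lt_min (lt_min hr₁ hr₂) (lt_min (by linarith) (lt_min (by linarith)
    (lt_min zero_lt_one (by linarith))))
  have hrr₁ : r ≤ r₁ := le_trans (min_le_left _ _) (min_le_left _ _)
  have hrr₂ : r ≤ r₂ := le_trans (min_le_left _ _) (min_le_right _ _)
  have hrs : r ≤ (z.1 - 1 / 2) / 2 := le_trans (min_le_right _ _) (min_le_left _ _)
  have hrs' : r ≤ (1 - z.1) / 2 := le_trans (min_le_right _ _) (le_trans (min_le_right _ _) (min_le_left _ _))
  have hr1' : r ≤ 1 :=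
    le_trans (min_le_right _ _) (le_trans (min_le_right _ _) (le_trans (min_le_right _ _) (min_le_left _ _)))
  have hry : r ≤ ⟪z.2, e⟫ - 1 :=
    le_trans (min_le_right _ _) (le_trans (min_le_right _ _) (le_trans (min_le_right _ _) (min_le_right _ _)))
  -- the ball `B(z, r)` lies in `G`
  have hball : ball z r ⊆ {w : ℝ × E | 1 / 2 + σ ≤ w.1 ∧ w.1 ≤ 1 ∧ 1 ≤ ⟪w.2, e⟫ ∧ ⟪w.2, e⟫ ≤ R₁ ∧
      4 * (Y₀ + 1) ^ 2 + 16 ≤ kA 1 w.1 * conePhi0 β η e w.2} := by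
    intro w hw
    rw [mem_ball] at hw
    have hw1 : dist w.1 z.1 < r := lt_of_le_of_lt (by rw [Prod.dist_eq]; exact le_max_left _ _) hw
    have hw2 : dist w.2 z.2 < r := lt_of_le_of_lt (by rw [Prod.dist_eq]; exact le_max_right _ _) hw
    rw [Real.dist_eq] at hw1
    rw [dist_eq_norm] at hw2
    have hws := abs_lt.1 hw1
    have hye : |⟪w.2, e⟫ - ⟪z.2, e⟫| ≤ ‖w.2 - z.2‖ := by
      rw [← inner_sub_left]
      have := abs_real_inner_le_norm (w.2 - z.2) e
      rwa [he, mul_one] at this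
    have hye' := abs_le.1 hye
    have hnw : ‖w.2‖ ≤ ‖z.2‖ + r := by
      have := norm_le_norm_add_norm_sub' w.2 z.2
      linarith
    have hwn : ⟪w.2, e⟫ ≤ ‖w.2‖ := by
      have := real_inner_le_norm w.2 e; rwa [he, mul_one] at this
    exact ⟨by linarith, by linarith, by linarith, by linarith, (hr₁' (lt_of_lt_of_le hw hrr₁)).le⟩
  -- the integral over the ball is positive
  have hballm : MeasurableSet (ball z r) := measurableSet_ball
  have hvol0 : 0 < volume (ball z r) := Metric.measure_ball_pos volume z hr0
  have hvoltop : volume (ball z r) < ∞ := measure_ball_lt_top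
  have hlowpt : ∀ w ∈ ball z r, ‖v z‖ ^ 2 / 4 ≤ ‖v w‖ ^ 2 := by
    intro w hw
    rw [mem_ball] at hw
    have h1 : dist (v w) (v z) < ‖v z‖ / 2 := hr₂' (lt_of_lt_of_le hw hrr₂)
    rw [dist_eq_norm] at h1
    have h2 : ‖v z‖ / 2 ≤ ‖v w‖ := by
      have := norm_sub_norm_le (v z) (v w)
      rw [← norm_neg, neg_sub] at h1
      linarith
    have h3 : (‖v z‖ / 2) ^ 2 ≤ ‖v w‖ ^ 2 := pow_le_pow_left₀ (by positivity) h2 2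
    linarith
  have hIpos : ‖v z‖ ^ 2 / 4 * (volume (ball z r)).toReal ≤ ∫ w in ball z r, ‖v w‖ ^ 2 := by
    have e1 : ∫ w in ball z r, ‖v z‖ ^ 2 / 4 = ‖v z‖ ^ 2 / 4 * (volume (ball z r)).toReal := by
      rw [setIntegral_const, smul_eq_mul, mul_comm]; rfl
    rw [← e1]
    refine setIntegral_mono_on (integrableOn_const hvoltop.ne) (hvG.mono_set hball) hballm hlowpt
  have hIle : ∫ w in ball z r, ‖v w‖ ^ 2 ≤ 0 := by
    rw [← hG0]
    exact setIntegral_mono_set hvG (ae_of_all _ fun w => sq_nonneg _) (Eventually.of_forall hball)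
  have hpos : 0 < ‖v z‖ ^ 2 / 4 * (volume (ball z r)).toReal :=
    mul_pos (by positivity) (ENNReal.toReal_pos hvol0.ne' hvoltop.ne)
  linarith

end ConeVanish

end Carleman

end Literature.Analysis.FluidPDE
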